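/-
Copyright (c) 2026 the pub-hodgecm-mathlib formalisation cell (harness21).  Prover seat hodgecm-mathlib-K2E3-p12 (g8), Track B ∕ K2-LIT, h413 = `stmt-HodgeConjecture-24833`,
line `K2_E1_TraceFormulaBeta`, 5Res ROADCARD «ENDGAME BY FAMILIES» (K2E1-plan (g7), (154)) file C1 «f3-χ» (deal (142)), part H-a: the idele class integral of ★ W-b SPLIT into its
`w = 1` term (character `χ·conj χ′`) and its `w = w₀` term (character `χ·conj χ′ʷ`), each integrable over `𝓕_I` — the input of Lemma B (★ GR-χ) for (XF)∕(OD)∕(SD).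
-/
import Summits.HodgeConjecture.HodgeConjecture.Theorems.K2E1ChiPseudoEisensteinIdeleLevelCMTwo      -- ★ W-b p859978 (this seat); transitively ★ D0-χ, ★ W-a, ★ Final §1, ★ C, Godement ★
import HarnessLib

/-!
# C1 «f3-χ», part H-a — `K2E1ChiPseudoEisensteinIdeleSplitCMTwo`: `⟨θ_{f,φ}, θ_{f′,φ′}⟩_X = C·( ∫_{𝓕_I} G₁ dν_I + ∫_{𝓕_I} G₂ dν_I )` with
# `G₁(x) = ‖x‖⁻¹•( χ(x)conj χ′(x) · f(‖x‖)conj f′(‖x‖)·⟪φ,φ′⟫_K )`, `G₂(x) = ‖x‖⁻¹•( χ(x)conj χ′ʷ(x) · f(‖x‖)·∫_K φ(k)·conj((ν𝓕)⁻¹•(2π)⁻¹∫_ℝ f̃′(z)‖x‖(‖x‖⁻¹)^z I_{φ′}(z,k) dy) dμ_K )`, BOTH INTEGRABLE ON `𝓕_I`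

Track B ∕ K2-LIT, crux h413 = `stmt-HodgeConjecture-24833`, route of record `HCCMUnconditional`; cell `hodgecm-mathlib`, squad K2, ENGINE E1.  THEOREMS ONLY (no `def`, no `instance`,
no `notation`, no named-fact hypothesis, no `sorry`); lane `--supports stmt-HodgeConjecture-24833 --as helper` (count-neutral).
THE MATHEMATICS ([MoeglinWaldspurger1995, II.1.7, II.2.1]; [Rogawski1990, §7.3]; [GelbartRogawski1991, §3.1]; ROADCARD (154) §1).  ★ W-b gives `⟨θ_{f,φ},θ_{f′,φ′}⟩ = C·∫_{𝓕_I} ‖x‖⁻¹•Φ(x)`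
with `Φ(x) = ∫_{K_U} B(x,k) dμ_K`.  For UNITARY `χ, χ′` this file splits `B = T₁ + T₂` pointwise (`conj` is additive; the `x`-constants `χ′ʷ(x)` leave the `y`-integral and the `K_U`-integral
unconditionally), integrates term by term over the compact `K_U` (`T₁(x,·)` continuous-bounded, `T₂(x,·)` Borel and bounded through the UNIFORM GODEMENT BOUND `|I_{φ′}(σ₀+iy, k)| ≤ C_{φ′}·c(σ₀)`,
`c(σ₀) = ∫_{N(𝔸)} H(w₀v)^{σ₀} dν` — ★ `integrable_borelHeight_weylLongU_mul_rpow_cm_two` + right-`K_U`-invariance of `H`), and proves `G₁, G₂ ∈ L¹(𝓕_I, ν_I)` by the radial majorants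
`‖x‖⁻¹|f(‖x‖)|·D_i` (`|χ| = |χ′| = |χ′ʷ| = 1`; on `supp f∘‖·‖` one has `‖x‖ ≥ T⁻¹`, ★ `exists_one_le_forall_eq_zero`) through ★ C `setLIntegral_inv_ideleNorm_mul_comp_eq` + ★ Final §1
`setLIntegral_inv_mul_inv_mul_enorm_lt_top`.  Consequences (part H-b): `G₁(a x) = (χχ′⁻¹)(a)G₁(x)`, `G₂(a x) = (χ(χ′ʷ)⁻¹)(a)G₂(x)` for norm-one `a`, so ★ GR-χ Lemma B kills `∫G₁` unless `χχ′⁻¹` is a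
norm twist and `∫G₂` unless `χ(χ′ʷ)⁻¹` is (ROADCARD (154) §1 (XF)∕(OD)); in the norm-twist cases ★ C ∘ ★ A evaluate them (Final's twin).
* §1 `norm_reflectChar_apply_of_isUnitary`, `norm_integral_flatSectionU_weylLongU_maximalCompact_le_cm_two` (uniform Godement bound on `K_U`).
* §2 **`chiPseudoEisenstein_inner_product_eq_sum_setIntegral_ideleClass_cm_two`** (the head).
HONEST LABEL: HC_CM is proved only modulo the 7 printed citations (2 remaining named inputs: hLiu418 = `stmt-HodgeConjecture-24832`, h413 = `stmt-HodgeConjecture-24833`) until rung 0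
closes; this file asserts no named fact, closes no socket; count-neutral; letter-free.

## References
* [MoeglinWaldspurger1995] C. Mœglin, J.-L. Waldspurger, *Spectral decomposition and Eisenstein series* (1995), II.1.5–II.1.7, II.2.1.
* [Rogawski1990] J. D. Rogawski, *Automorphic Representations of Unitary Groups in Three Variables* (1990), §7.3 pp. 96–98.
* [GelbartRogawski1991] S. Gelbart, J. Rogawski, *L-functions and Fourier–Jacobi coefficients for the unitary group U(3)*, Invent. Math. 105 (1991), §3.1.
-/

set_option autoImplicit false
set_option linter.dupNamespace false  -- the mandated namespace repeats the summit's segment (`HodgeConjecture.HodgeConjecture`)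

noncomputable section

open MeasureTheory Measure Set Filter Topology Complex NumberField IsDedekindDomain MulAction
open scoped Real NNReal ENNReal ComplexConjugate Pointwise
open Literature.MeasureTheory.Group Literature.NumberTheory
open Literature.NumberTheory.Automorphic Literature.NumberTheory.Automorphic.UnitaryGroup AdelicGroupData
open Literature.NumberTheory.GaloisRepresentations (HeckeCharacter ideleGroup)
open Summit.HodgeConjecture.HodgeConjecture.Cruxes.H413.K2E1BorelEisensteinU
open Summit.HodgeConjecture.HodgeConjecture.Cruxes.H413.K2E1CharacterEisensteinU2Defs
open Summit.HodgeConjecture.HodgeConjecture.Cruxes.H413.K2E1MellinPaleyWienerHalfLine (differentiable_mellin)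
open Summit.HodgeConjecture.HodgeConjecture.Cruxes.H413.K2E1IdeleClassRadialIntegralCM (setLIntegral_inv_ideleNorm_mul_comp_eq)
open Summit.HodgeConjecture.HodgeConjecture.Cruxes.H413.K2E1PseudoEisensteinRadialCMTwo (exists_one_le_forall_eq_zero)
open Summit.HodgeConjecture.HodgeConjecture.Cruxes.H413.K2E1ChiPseudoEisensteinIdeleLevelCMTwo (chiPseudoEisenstein_inner_product_eq_setIntegral_ideleClass_cm_two)
open Summit.HodgeConjecture.HodgeConjecture.Cruxes.H413.K2E1PseudoEisensteinInnerProductCMTwoFinal (setLIntegral_inv_mul_inv_mul_enorm_lt_top continuous_and_integrable_norm_mellin_neg)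
open Summit.HodgeConjecture.HodgeConjecture.Cruxes.H413.K2E1IntertwinedCoeffContinuousCMTwo (integrable_borelHeight_weylLongU_mul_rpow_cm_two)
open Summit.HodgeConjecture.HodgeConjecture.Cruxes.H413.K2E1UnipotentHaarNormalisationU2 (isInvInvariant_of_isHaarMeasure_two)
open Summit.HodgeConjecture.HodgeConjecture.Cruxes.H413.K2E1SphericalIntertwiningMellinCMTwo (sigmaFinite_haar_adelicUnipotent_cm_two)
open Summit.HodgeConjecture.HodgeConjecture.Cruxes.H413.K2E1MaassSelbergSphericalBracketsCMTwo (measureReal_maximalCompact_pos)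

namespace Summit.HodgeConjecture.HodgeConjecture.Cruxes.H413.K2E1ChiPseudoEisensteinIdeleSplitCMTwo

/-! ## §1 Two small inputs: `|χʷ| = 1` for unitary `χ`; the uniform Godement bound of `I_{φ′}(z, k)` on `K_U` -/

section Inputs

variable {F E : Type} [Field F] [NumberField F] [Field E] [NumberField E] [Algebra F E] {c : E ≃ₐ[F] E}

omit [NumberField F] in
/-- `‖χʷ(a)‖ = 1` for a unitary `χ` (`χʷ(a) = χ(c a)⁻¹`). [folklore] -/
theorem norm_reflectChar_apply_of_isUnitary {χ : HeckeCharacter E} (hχ : χ.IsUnitary) (a : ideleGroup E) : ‖((reflectChar c χ a : ℂˣ) : ℂ)‖ = 1 := by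
  rw [reflectChar_apply, Units.val_inv_eq_inv_val, norm_inv, hχ, inv_one]

end Inputs

variable (L : Type) [Field L] [NumberField L] [IsCMField L]
variable [MeasurableSpace (quasiSplit (↥(maximalRealSubfield L)) L (IsCMField.complexConj L) 2).Adelic] [BorelSpace (quasiSplit (↥(maximalRealSubfield L)) L (IsCMField.complexConj L) 2).Adelic]

/-- **UNIFORM GODEMENT BOUND ON `K_U`**: `‖∫_{N(𝔸)} (φ′H^z)(w₀ v k) dν‖ ≤ C_{φ′}·∫_{N(𝔸)} H(w₀ v)^{Re z} dν` for `k ∈ K_U`, `Re z > 1`, `‖φ′‖ ≤ C_{φ′}` (`|H^z| = H^{Re z}`, `H(w₀ v k) = H(w₀ v)` by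
right-`K_U`-invariance, ★ Godement integrability in the CM rank-one case). [cite: MoeglinWaldspurger1995, II.1.5] [cite: Garrett2018, §2.8] -/
theorem norm_integral_flatSectionU_weylLongU_maximalCompact_le_cm_two (ν : Measure ↥(adelicUnipotent (↥(maximalRealSubfield L)) L (IsCMField.complexConj L) 2)) [ν.IsHaarMeasure]
    {𝓕 : Set ↥(adelicUnipotent (↥(maximalRealSubfield L)) L (IsCMField.complexConj L) 2)} (h𝓕N : IsFundamentalDomain ↥(rationalUnipotent (↥(maximalRealSubfield L)) L (IsCMField.complexConj L) 2) 𝓕 ν) (h𝓕c : IsCompact (closure 𝓕))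
    {φ' : (quasiSplit (↥(maximalRealSubfield L)) L (IsCMField.complexConj L) 2).Adelic → ℂ} {Cφ' : ℝ} (hφ'C : ∀ x, ‖φ' x‖ ≤ Cφ') {z : ℂ} (hz : 1 < z.re) (k : ((standardMaximalCompactGL 2 L).comap (adelicVal (↥(maximalRealSubfield L)) L (IsCMField.complexConj L) 2 ((StdForm.antidiagonal 2).over L)) : Subgroup (quasiSplit (↥(maximalRealSubfield L)) L (IsCMField.complexConj L) 2).Adelic)) :
    ‖∫ v : ↥(adelicUnipotent (↥(maximalRealSubfield L)) L (IsCMField.complexConj L) 2), flatSectionU φ' z (((quasiSplit (↥(maximalRealSubfield L)) L (IsCMField.complexConj L) 2).toAdelic (weylLongU ((IsCMField.complexConj L : L ≃ₐ[↥(maximalRealSubfield L)] L) : L →+* L) (rfl : (StdForm.antidiagonal 2).over L = (StdForm.antidiagonal 2).over L))) * ((v : (quasiSplit (↥(maximalRealSubfield L)) L (IsCMField.complexConj L) 2).Adelic) * (k : (quasiSplit (↥(maximalRealSubfield L)) L (IsCMField.complexConj L) 2).Adelic))) ∂ν‖ ≤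
      Cφ' * ∫ v : ↥(adelicUnipotent (↥(maximalRealSubfield L)) L (IsCMField.complexConj L) 2), (borelHeight (((quasiSplit (↥(maximalRealSubfield L)) L (IsCMField.complexConj L) 2).toAdelic (weylLongU ((IsCMField.complexConj L : L ≃ₐ[↥(maximalRealSubfield L)] L) : L →+* L) (rfl : (StdForm.antidiagonal 2).over L = (StdForm.antidiagonal 2).over L))) * (v : (quasiSplit (↥(maximalRealSubfield L)) L (IsCMField.complexConj L) 2).Adelic)) : ℝ) ^ z.re ∂ν := by
  haveI := locallyCompactSpace_adeleRing' L
  haveI : ν.IsInvInvariant := isInvInvariant_of_isHaarMeasure_two ν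
  have hK : ∀ v : ↥(adelicUnipotent (↥(maximalRealSubfield L)) L (IsCMField.complexConj L) 2), borelHeight (((quasiSplit (↥(maximalRealSubfield L)) L (IsCMField.complexConj L) 2).toAdelic (weylLongU ((IsCMField.complexConj L : L ≃ₐ[↥(maximalRealSubfield L)] L) : L →+* L) (rfl : (StdForm.antidiagonal 2).over L = (StdForm.antidiagonal 2).over L))) * ((v : (quasiSplit (↥(maximalRealSubfield L)) L (IsCMField.complexConj L) 2).Adelic) * (k : (quasiSplit (↥(maximalRealSubfield L)) L (IsCMField.complexConj L) 2).Adelic))) = borelHeight (((quasiSplit (↥(maximalRealSubfield L)) L (IsCMField.complexConj L) 2).toAdelic (weylLongU ((IsCMField.complexConj L : L ≃ₐ[↥(maximalRealSubfield L)] L) : L →+* L) (rfl : (StdForm.antidiagonal 2).over L = (StdForm.antidiagonal 2).over L))) * (v : (quasiSplit (↥(maximalRealSubfield L)) L (IsCMField.complexConj L) 2).Adelic)) := fun v => by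
    rw [← mul_assoc, borelHeight_mul_of_mem_comap_standardMaximalCompactGL k.2]
  have hI := integrable_borelHeight_weylLongU_mul_rpow_cm_two L ν h𝓕N h𝓕c hz (1 : (quasiSplit (↥(maximalRealSubfield L)) L (IsCMField.complexConj L) 2).Adelic)
  simp only [mul_one] at hI
  rw [← integral_const_mul]
  refine norm_integral_le_of_norm_le (hI.const_mul Cφ') (ae_of_all _ fun v => ?_)
  have hp : (0 : ℝ) < (borelHeight (((quasiSplit (↥(maximalRealSubfield L)) L (IsCMField.complexConj L) 2).toAdelic (weylLongU ((IsCMField.complexConj L : L ≃ₐ[↥(maximalRealSubfield L)] L) : L →+* L) (rfl : (StdForm.antidiagonal 2).over L = (StdForm.antidiagonal 2).over L))) * ((v : (quasiSplit (↥(maximalRealSubfield L)) L (IsCMField.complexConj L) 2).Adelic) * (k : (quasiSplit (↥(maximalRealSubfield L)) L (IsCMField.complexConj L) 2).Adelic))) : ℝ) := by exact_mod_cast borelHeight_pos _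
  rw [flatSectionU_apply, norm_mul, Complex.norm_cpow_eq_rpow_re_of_pos hp, hK v]
  exact mul_le_mul_of_nonneg_right (hφ'C _) (Real.rpow_nonneg (NNReal.coe_nonneg _) _)

variable [MeasurableSpace (AdeleRing (𝓞 L) L)ˣ] [BorelSpace (AdeleRing (𝓞 L) L)ˣ]

/-! ## §2 The HEAD: the split idele class integral, both terms integrable -/

set_option maxHeartbeats 400000 in
/-- **`⟨θ_{f,φ}, θ_{f′,φ′}⟩_X = C·( ∫_{𝓕_I} G₁ + ∫_{𝓕_I} G₂ )`, `G₁, G₂ ∈ L¹(𝓕_I)`** for UNITARY Hecke characters `χ, χ′`, continuous bounded `χ`-∕`χ′`-sections `φ, φ′`, `f, f′ ∈ C²_c((0,∞))`, `σ₀ > 1`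
(data and `C` exactly as in ★ W-b; `z = σ₀ + iy`, `I(z,k) = ∫_{N(𝔸)}(φ′H^z)(w₀ v k) dν`, `χ′ʷ = reflectChar c χ′`):
`G₁(x) = ‖x‖⁻¹ • ( (χ(x)·conj χ′(x)) · ((f(‖x‖)·conj f′(‖x‖)) · ∫_{K_U} φ·conj φ′ dμ_K) )` (the `w = 1` term) and
`G₂(x) = ‖x‖⁻¹ • ( (χ(x)·conj χ′ʷ(x)) · (f(‖x‖) · ∫_{K_U} φ(k)·conj( (ν𝓕)⁻¹ • ((2π)⁻¹·∫_ℝ f̃′(z)·(‖x‖·(‖x‖⁻¹)^z·I(z,k)) dy) ) dμ_K) )` (the `w = w₀` term).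
[cite: MoeglinWaldspurger1995, II.2.1] [cite: Rogawski1990, §7.3 (pp. 96–98)] [cite: GelbartRogawski1991, §3.1] -/
theorem chiPseudoEisenstein_inner_product_eq_sum_setIntegral_ideleClass_cm_two
    (μ : Measure (quasiSplit (↥(maximalRealSubfield L)) L (IsCMField.complexConj L) 2).automorphicQuotient) [(quasiSplit (↥(maximalRealSubfield L)) L (IsCMField.complexConj L) 2).IsAutomorphicMeasure μ]
    (νG : Measure (quasiSplit (↥(maximalRealSubfield L)) L (IsCMField.complexConj L) 2).Adelic) [νG.IsHaarMeasure] [νG.IsInvInvariant]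
    (μK : Measure ((standardMaximalCompactGL 2 L).comap (adelicVal (↥(maximalRealSubfield L)) L (IsCMField.complexConj L) 2 ((StdForm.antidiagonal 2).over L)) : Subgroup (quasiSplit (↥(maximalRealSubfield L)) L (IsCMField.complexConj L) 2).Adelic)) [μK.IsHaarMeasure]
    (νI : Measure (AdeleRing (𝓞 L) L)ˣ) [νI.IsHaarMeasure]
    {𝓕I : Set (AdeleRing (𝓞 L) L)ˣ} (h𝓕I : IsIdeleClassDomain L 𝓕I)
    (ν : Measure ↥(adelicUnipotent (↥(maximalRealSubfield L)) L (IsCMField.complexConj L) 2)) [ν.IsHaarMeasure] {𝓕 : Set ↥(adelicUnipotent (↥(maximalRealSubfield L)) L (IsCMField.complexConj L) 2)}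
    (h𝓕N : IsFundamentalDomain ↥(rationalUnipotent (↥(maximalRealSubfield L)) L (IsCMField.complexConj L) 2) 𝓕 ν) (h𝓕c : IsCompact (closure 𝓕)) (h𝓕₀ : ν 𝓕 ≠ 0) :
    ∃ C : ℝ, 0 < C ∧
      ∀ {χ χ' : HeckeCharacter L} {φ φ' : (quasiSplit (↥(maximalRealSubfield L)) L (IsCMField.complexConj L) 2).Adelic → ℂ}, χ.IsUnitary → χ'.IsUnitary →
        IsChiSection χ φ → Continuous φ → ∀ {Cφ : ℝ}, (∀ x, ‖φ x‖ ≤ Cφ) →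
        IsChiSection χ' φ' → Continuous φ' → ∀ {Cφ' : ℝ}, (∀ x, ‖φ' x‖ ≤ Cφ') →
      ∀ {f f' : ℝ → ℂ}, ContDiff ℝ 2 f → HasCompactSupport f → tsupport f ⊆ Ioi 0 → ContDiff ℝ 2 f' → HasCompactSupport f' → tsupport f' ⊆ Ioi 0 →
      ∀ {σ₀ : ℝ}, 1 < σ₀ →
        IntegrableOn (fun x : (AdeleRing (𝓞 L) L)ˣ => (IdeleClassGroup.ideleNorm L x : ℝ)⁻¹ • ((((χ x : ℂˣ) : ℂ) * conj (((χ' x : ℂˣ) : ℂ))) * ((f (IdeleClassGroup.ideleNorm L x : ℝ) * conj (f' (IdeleClassGroup.ideleNorm L x : ℝ))) * ∫ k : ((standardMaximalCompactGL 2 L).comap (adelicVal (↥(maximalRealSubfield L)) L (IsCMField.complexConj L) 2 ((StdForm.antidiagonal 2).over L)) : Subgroup (quasiSplit (↥(maximalRealSubfield L)) L (IsCMField.complexConj L) 2).Adelic), φ (k : (quasiSplit (↥(maximalRealSubfield L)) L (IsCMField.complexConj L) 2).Adelic) * conj (φ' (k : (quasiSplit (↥(maximalRealSubfield L)) L (IsCMField.complexConj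 L) 2).Adelic)) ∂μK))) 𝓕I νI ∧
        IntegrableOn (fun x : (AdeleRing (𝓞 L) L)ˣ => (IdeleClassGroup.ideleNorm L x : ℝ)⁻¹ • ((((χ x : ℂˣ) : ℂ) * conj ((((reflectChar (IsCMField.complexConj L) χ') x : ℂˣ) : ℂ))) * (f (IdeleClassGroup.ideleNorm L x : ℝ) * ∫ k : ((standardMaximalCompactGL 2 L).comap (adelicVal (↥(maximalRealSubfield L)) L (IsCMField.complexConj L) 2 ((StdForm.antidiagonal 2).over L)) : Subgroup (quasiSplit (↥(maximalRealSubfield L)) L (IsCMField.complexConj L) 2).Adelic), φ (k : (quasiSplit (↥(maximalRealSubfield L)) L (IsCMField.complexConj L) 2).Adelic) * conj (((ν 𝓕).toReal⁻¹ : ℝ) • ((((2 * π)⁻¹ : ℝ) : ℂ) * ∫ y : ℝ, mellin f' (-((σ₀ : ℂ) + y * I)) * (((((IdeleClassGroup.ideleNorm L x : ℝ≥0) : ℝ) : ℂ) * ((((IdeleClassGroup.ideleNorm L x)⁻¹ : ℝ≥0) : ℝ) : ℂ) ^ ((σ₀ : ℂ) + y * I)) * ∫ v : ↥(adelicUnipotent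 (↥(maximalRealSubfield L)) L (IsCMField.complexConj L) 2), flatSectionU φ' ((σ₀ : ℂ) + y * I) (((quasiSplit (↥(maximalRealSubfield L)) L (IsCMField.complexConj L) 2).toAdelic (weylLongU ((IsCMField.complexConj L : L ≃ₐ[↥(maximalRealSubfield L)] L) : L →+* L) (rfl : (StdForm.antidiagonal 2).over L = (StdForm.antidiagonal 2).over L))) * ((v : (quasiSplit (↥(maximalRealSubfield L)) L (IsCMField.complexConj L) 2).Adelic) * (k : (quasiSplit (↥(maximalRealSubfield L)) L (IsCMField.complexConj L) 2).Adelic))) ∂ν))) ∂μK))) 𝓕I νI ∧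
        Integrable (fun x : (quasiSplit (↥(maximalRealSubfield L)) L (IsCMField.complexConj L) 2).automorphicQuotient =>
            (quasiSplit (↥(maximalRealSubfield L)) L (IsCMField.complexConj L) 2).quotFun (eisensteinSeriesU (fun g : (quasiSplit (↥(maximalRealSubfield L)) L (IsCMField.complexConj L) 2).Adelic => f (borelHeight g : ℝ) * φ g)) x *
              conj ((quasiSplit (↥(maximalRealSubfield L)) L (IsCMField.complexConj L) 2).quotFun (eisensteinSeriesU (fun g : (quasiSplit (↥(maximalRealSubfield L)) L (IsCMField.complexConj L) 2).Adelic => f' (borelHeight g : ℝ) * φ' g)) x)) μ ∧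
        ∫ x, (quasiSplit (↥(maximalRealSubfield L)) L (IsCMField.complexConj L) 2).quotFun (eisensteinSeriesU (fun g : (quasiSplit (↥(maximalRealSubfield L)) L (IsCMField.complexConj L) 2).Adelic => f (borelHeight g : ℝ) * φ g)) x * conj ((quasiSplit (↥(maximalRealSubfield L)) L (IsCMField.complexConj L) 2).quotFun (eisensteinSeriesU (fun g : (quasiSplit (↥(maximalRealSubfield L)) L (IsCMField.complexConj L) 2).Adelic => f' (borelHeight g : ℝ) * φ' g)) x) ∂μ =
          (C : ℂ) * ((∫ x in 𝓕I, (IdeleClassGroup.ideleNorm L x : ℝ)⁻¹ • ((((χ x : ℂˣ) : ℂ) * conj (((χ' x : ℂˣ) : ℂ))) * ((f (IdeleClassGroup.ideleNorm L x : ℝ) * conj (f' (IdeleClassGroup.ideleNorm L x : ℝ))) * ∫ k : ((standardMaximalCompactGL 2 L).comap (adelicVal (↥(maximalRealSubfield L)) L (IsCMField.complexConj L) 2 ((StdForm.antidiagonal 2).over L)) : Subgroup (quasiSplit (↥(maximalRealSubfield L)) L (IsCMField.complexConj L) 2).Adelic), φ (k : (quasiSplit (↥(maximalRealSubfield L)) L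 (IsCMField.complexConj L) 2).Adelic) * conj (φ' (k : (quasiSplit (↥(maximalRealSubfield L)) L (IsCMField.complexConj L) 2).Adelic)) ∂μK)) ∂νI) + ∫ x in 𝓕I, (IdeleClassGroup.ideleNorm L x : ℝ)⁻¹ • ((((χ x : ℂˣ) : ℂ) * conj ((((reflectChar (IsCMField.complexConj L) χ') x : ℂˣ) : ℂ))) * (f (IdeleClassGroup.ideleNorm L x : ℝ) * ∫ k : ((standardMaximalCompactGL 2 L).comap (adelicVal (↥(maximalRealSubfield L)) L (IsCMField.complexConj L) 2 ((StdForm.antidiagonal 2).over L)) : Subgroup (quasiSplit (↥(maximalRealSubfield L)) L (IsCMField.complexConj L) 2).Adelic), φ (k : (quasiSplit (↥(maximalRealSubfield L)) L (IsCMField.complexConj L) 2).Adelic) * conj (((ν 𝓕).toReal⁻¹ : ℝ) • ((((2 * π)⁻¹ : ℝ) : ℂ) * ∫ y : ℝ, mellin f' (-((σ₀ : ℂ) + y * I)) * (((((IdeleClassGroup.ideleNorm L x : ℝ≥0) : ℝ) : ℂ) * ((((IdeleClassGroup.ideleNorm L x)⁻¹ : ℝ≥0) : ℝ) : ℂ)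 ^ ((σ₀ : ℂ) + y * I)) * ∫ v : ↥(adelicUnipotent (↥(maximalRealSubfield L)) L (IsCMField.complexConj L) 2), flatSectionU φ' ((σ₀ : ℂ) + y * I) (((quasiSplit (↥(maximalRealSubfield L)) L (IsCMField.complexConj L) 2).toAdelic (weylLongU ((IsCMField.complexConj L : L ≃ₐ[↥(maximalRealSubfield L)] L) : L →+* L) (rfl : (StdForm.antidiagonal 2).over L = (StdForm.antidiagonal 2).over L))) * ((v : (quasiSplit (↥(maximalRealSubfield L)) L (IsCMField.complexConj L) 2).Adelic) * (k : (quasiSplit (↥(maximalRealSubfield L)) L (IsCMField.complexConj L) 2).Adelic))) ∂ν))) ∂μK)) ∂νI) := by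
  classical
  haveI := t2Space_adeleRing_of_numberField L
  haveI := locallyCompactSpace_adeleRing' L
  haveI := secondCountableTopology_adeleRing L
  haveI : SecondCountableTopology (quasiSplit (↥(maximalRealSubfield L)) L (IsCMField.complexConj L) 2).Adelic := inferInstanceAs (SecondCountableTopology (adelic (↥(maximalRealSubfield L)) L (IsCMField.complexConj L) 2 ((StdForm.antidiagonal 2).over L)))
  haveI := sigmaFinite_haar_adelicUnipotent_cm_two L ν
  have hKc : IsCompact ((((standardMaximalCompactGL 2 L).comap (adelicVal (↥(maximalRealSubfield L)) L (IsCMField.complexConj L) 2 ((StdForm.antidiagonal 2).over L)) : Subgroup (quasiSplit (↥(maximalRealSubfield L)) L (IsCMField.complexConj L) 2).Adelic)) : Set (quasiSplit (↥(maximalRealSubfield L)) L (IsCMField.complexConj L) 2).Adelic) := isCompact_comap_adelicVal_standardMaximalCompactGL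
  haveI : CompactSpace ((standardMaximalCompactGL 2 L).comap (adelicVal (↥(maximalRealSubfield L)) L (IsCMField.complexConj L) 2 ((StdForm.antidiagonal 2).over L)) : Subgroup (quasiSplit (↥(maximalRealSubfield L)) L (IsCMField.complexConj L) 2).Adelic) := isCompact_iff_compactSpace.1 hKc
  haveI : IsFiniteMeasure μK := CompactSpace.isFiniteMeasure
  have hVt : idelicCovolume L νI ≠ ∞ := idelicCovolume_ne_top νI
  obtain ⟨C, hC, hW⟩ := chiPseudoEisenstein_inner_product_eq_setIntegral_ideleClass_cm_two L μ νG μK νI h𝓕I ν h𝓕N h𝓕c h𝓕₀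
  refine ⟨C, hC, ?_⟩
  intro χ χ' φ φ' hχu hχ'u hφ hφc Cφ hφC hφ' hφ'c Cφ' hφ'C f f' hf hfs hf0 hf' hf's hf'0 σ₀ hσ₀
  obtain ⟨hInt, hEq⟩ := hW hφ hφc hφC hφ' hφ'c hφ'C hf hfs hf0 hf' hf's hf'0 hσ₀
  have hIc : Continuous fun x : (AdeleRing (𝓞 L) L)ˣ => (IdeleClassGroup.ideleNorm L x : ℝ) := NNReal.continuous_coe.comp (continuous_ideleNorm_holds L)
  have hIic : Continuous fun x : (AdeleRing (𝓞 L) L)ˣ => ((((IdeleClassGroup.ideleNorm L x)⁻¹ : ℝ≥0) : ℝ) : ℂ) :=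
    continuous_ofReal.comp (NNReal.continuous_coe.comp ((continuous_ideleNorm_holds L).inv₀ fun x => ne_of_gt (by exact_mod_cast ideleNorm_real_pos x)))
  have hHc : Continuous fun g : (quasiSplit (↥(maximalRealSubfield L)) L (IsCMField.complexConj L) 2).Adelic => (borelHeight g : ℝ) := NNReal.continuous_coe.comp continuous_borelHeight
  have hχc : ∀ ξ : HeckeCharacter L, Continuous fun x : (AdeleRing (𝓞 L) L)ˣ => ((ξ x : ℂˣ) : ℂ) := fun ξ => Units.continuous_val.comp (map_continuous ξ)
  have hCφ : 0 ≤ Cφ := (norm_nonneg _).trans (hφC 1)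
  have hCφ' : 0 ≤ Cφ' := (norm_nonneg _).trans (hφ'C 1)
  -- constants: `κ = (ν𝓕)⁻¹`, `A = ⟪φ,φ′⟫_K`, `c₀ = ∫ H(w₀v)^σ₀`, `Mf′ = ∫|f̃′(z)|dy`, the cut-off `T` of `f`
  set κN : ℝ := (ν 𝓕).toReal⁻¹ with hκN
  set c₀ : ℝ := ∫ v : ↥(adelicUnipotent (↥(maximalRealSubfield L)) L (IsCMField.complexConj L) 2), (borelHeight (((quasiSplit (↥(maximalRealSubfield L)) L (IsCMField.complexConj L) 2).toAdelic (weylLongU ((IsCMField.complexConj L : L ≃ₐ[↥(maximalRealSubfield L)] L) : L →+* L) (rfl : (StdForm.antidiagonal 2).over L = (StdForm.antidiagonal 2).over L))) * (v : (quasiSplit (↥(maximalRealSubfield L)) L (IsCMField.complexConj L) 2).Adelic)) : ℝ) ^ σ₀ ∂ν with hc₀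
  obtain ⟨hGc, hGi⟩ := continuous_and_integrable_norm_mellin_neg hf' hf's hf'0 σ₀
  set Mf' : ℝ := ∫ y : ℝ, ‖mellin f' (-((σ₀ : ℂ) + y * I))‖ with hMf'
  obtain ⟨T, hT, hhi, hlo⟩ := exists_one_le_forall_eq_zero hfs hf0
  have hT0 : (0 : ℝ) < T := by exact_mod_cast one_pos.trans_le hT
  -- (1) the uniform bound `|I(z,k)| ≤ Cφ′·c₀` and the bound of the `y`-integral `Y(x,k)`
  have hIb : ∀ (y : ℝ) (k : ((standardMaximalCompactGL 2 L).comap (adelicVal (↥(maximalRealSubfield L)) L (IsCMField.complexConj L) 2 ((StdForm.antidiagonal 2).over L)) : Subgroup (quasiSplit (↥(maximalRealSubfield L)) L (IsCMField.complexConj L) 2).Adelic)), ‖∫ v : ↥(adelicUnipotent (↥(maximalRealSubfield L)) L (IsCMField.complexConj L) 2), flatSectionU φ' ((σ₀ : ℂ) + y * I) (((quasiSplit (↥(maximalRealSubfield L)) L (IsCMField.complexConj L) 2).toAdelic (weylLongU ((IsCMField.complexConj L : L ≃ₐ[↥(maximalRealSubfield L)] L) : L →+* L) (rfl : (StdForm.antidiagonal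 2).over L = (StdForm.antidiagonal 2).over L))) * ((v : (quasiSplit (↥(maximalRealSubfield L)) L (IsCMField.complexConj L) 2).Adelic) * (k : (quasiSplit (↥(maximalRealSubfield L)) L (IsCMField.complexConj L) 2).Adelic))) ∂ν‖ ≤ Cφ' * c₀ := fun y k => by
    have h := norm_integral_flatSectionU_weylLongU_maximalCompact_le_cm_two L ν h𝓕N h𝓕c hφ'C (z := (σ₀ : ℂ) + y * I) (by simpa using hσ₀) k
    simpa using h
  have hYb : ∀ (x : (AdeleRing (𝓞 L) L)ˣ) (k : ((standardMaximalCompactGL 2 L).comap (adelicVal (↥(maximalRealSubfield L)) L (IsCMField.complexConj L) 2 ((StdForm.antidiagonal 2).over L)) : Subgroup (quasiSplit (↥(maximalRealSubfield L)) L (IsCMField.complexConj L) 2).Adelic)), ‖∫ y : ℝ, mellin f' (-((σ₀ : ℂ) + y * I)) * (((((IdeleClassGroup.ideleNorm L x : ℝ≥0) : ℝ) : ℂ) * ((((IdeleClassGroup.ideleNorm L x)⁻¹ : ℝ≥0) : ℝ) : ℂ) ^ ((σ₀ : ℂ) + y * I)) * ∫ v : ↥(adelicUnipotent (↥(maximalRealSubfield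 L)) L (IsCMField.complexConj L) 2), flatSectionU φ' ((σ₀ : ℂ) + y * I) (((quasiSplit (↥(maximalRealSubfield L)) L (IsCMField.complexConj L) 2).toAdelic (weylLongU ((IsCMField.complexConj L : L ≃ₐ[↥(maximalRealSubfield L)] L) : L →+* L) (rfl : (StdForm.antidiagonal 2).over L = (StdForm.antidiagonal 2).over L))) * ((v : (quasiSplit (↥(maximalRealSubfield L)) L (IsCMField.complexConj L) 2).Adelic) * (k : (quasiSplit (↥(maximalRealSubfield L)) L (IsCMField.complexConj L) 2).Adelic))) ∂ν)‖ ≤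
      Mf' * ((IdeleClassGroup.ideleNorm L x : ℝ) * (((IdeleClassGroup.ideleNorm L x)⁻¹ : ℝ≥0) : ℝ) ^ σ₀ * (Cφ' * c₀)) := fun x k => by
    rw [hMf', ← integral_mul_const]
    refine norm_integral_le_of_norm_le (hGi.mul_const _) (ae_of_all _ fun y => ?_)
    have hp : (0 : ℝ) < (((IdeleClassGroup.ideleNorm L x)⁻¹ : ℝ≥0) : ℝ) := NNReal.coe_pos.2 (inv_pos.2 (by exact_mod_cast ideleNorm_real_pos x))
    rw [norm_mul, norm_mul, norm_mul, Complex.norm_of_nonneg (NNReal.coe_nonneg _), Complex.norm_cpow_eq_rpow_re_of_pos hp]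
    simp only [Complex.add_re, Complex.ofReal_re, Complex.mul_re, Complex.I_re, Complex.I_im, Complex.ofReal_im, mul_zero, zero_mul, sub_self, add_zero]
    exact mul_le_mul_of_nonneg_left (mul_le_mul_of_nonneg_left (hIb y k) (mul_nonneg (NNReal.coe_nonneg _) (Real.rpow_nonneg (NNReal.coe_nonneg _) _))) (norm_nonneg _)
  -- (2) measurability: `I(z,k)` in `(k,y)`, the `y`-integrand, `Y(x,k) = ∫_y …`, the `K_U`-integrand of the `w₀`-term
  have hmW : Continuous fun q : (((standardMaximalCompactGL 2 L).comap (adelicVal (↥(maximalRealSubfield L)) L (IsCMField.complexConj L) 2 ((StdForm.antidiagonal 2).over L)) : Subgroup (quasiSplit (↥(maximalRealSubfield L)) L (IsCMField.complexConj L) 2).Adelic) × ℝ) × ↥(adelicUnipotent (↥(maximalRealSubfield L)) L (IsCMField.complexConj L) 2) => ((quasiSplit (↥(maximalRealSubfield L)) L (IsCMField.complexConj L) 2).toAdelic (weylLongU ((IsCMField.complexConj L : L ≃ₐ[↥(maximalRealSubfield L)] L) : L →+* L) (rfl : (StdForm.antidiagonal 2).over L = (StdForm.antidiagonal 2).over L)))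 * ((q.2 : (quasiSplit (↥(maximalRealSubfield L)) L (IsCMField.complexConj L) 2).Adelic) * (q.1.1 : (quasiSplit (↥(maximalRealSubfield L)) L (IsCMField.complexConj L) 2).Adelic)) :=
    continuous_const.mul ((continuous_subtype_val.comp continuous_snd).mul (continuous_subtype_val.comp (continuous_fst.comp continuous_fst)))
  have hR : Measurable fun q : (((standardMaximalCompactGL 2 L).comap (adelicVal (↥(maximalRealSubfield L)) L (IsCMField.complexConj L) 2 ((StdForm.antidiagonal 2).over L)) : Subgroup (quasiSplit (↥(maximalRealSubfield L)) L (IsCMField.complexConj L) 2).Adelic) × ℝ) × ↥(adelicUnipotent (↥(maximalRealSubfield L)) L (IsCMField.complexConj L) 2) => flatSectionU φ' ((σ₀ : ℂ) + q.1.2 * I) (((quasiSplit (↥(maximalRealSubfield L)) L (IsCMField.complexConj L) 2).toAdelic (weylLongU ((IsCMField.complexConj L : L ≃ₐ[↥(maximalRealSubfield L)] L) : L →+* L) (rfl : (StdForm.antidiagonal 2).over L = (StdForm.antidiagonal 2).over L))) * ((q.2 : (quasiSplit (↥(maximalRealSubfield L)) L (IsCMField.complexConj L) 2).Adelic) * (q.1.1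 : (quasiSplit (↥(maximalRealSubfield L)) L (IsCMField.complexConj L) 2).Adelic))) := by
    simp only [flatSectionU_apply]
    exact (hφ'c.measurable.comp hmW.measurable).mul (((continuous_ofReal.comp hHc).measurable.comp hmW.measurable).pow (by fun_prop))
  set Iφ' : ((standardMaximalCompactGL 2 L).comap (adelicVal (↥(maximalRealSubfield L)) L (IsCMField.complexConj L) 2 ((StdForm.antidiagonal 2).over L)) : Subgroup (quasiSplit (↥(maximalRealSubfield L)) L (IsCMField.complexConj L) 2).Adelic) × ℝ → ℂ := fun p => ∫ v : ↥(adelicUnipotent (↥(maximalRealSubfield L)) L (IsCMField.complexConj L) 2), flatSectionU φ' ((σ₀ : ℂ) + p.2 * I) (((quasiSplit (↥(maximalRealSubfield L)) L (IsCMField.complexConj L) 2).toAdelic (weylLongU ((IsCMField.complexConj L : L ≃ₐ[↥(maximalRealSubfield L)] L) : L →+* L) (rfl : (StdForm.antidiagonal 2).over L = (StdForm.antidiagonal 2).over L))) * ((v : (quasiSplit (↥(maximalRealSubfield L)) L (IsCMField.complexConj L) 2).Adelic) * (p.1 : (quasiSplit (↥(maximalRealSubfield L)) L (IsCMField.complexConj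 L) 2).Adelic))) ∂ν with hIφ'def
  have hIφ'm : Measurable Iφ' := (hR.stronglyMeasurable.integral_prod_right' (ν := ν)).measurable
  have hmel : Continuous fun y : ℝ => mellin f' (-((σ₀ : ℂ) + y * I)) := (differentiable_mellin hf'.continuous hf's hf'0).continuous.comp (by fun_prop : Continuous fun y : ℝ => -((σ₀ : ℂ) + y * I))
  set S' : ((AdeleRing (𝓞 L) L)ˣ × ((standardMaximalCompactGL 2 L).comap (adelicVal (↥(maximalRealSubfield L)) L (IsCMField.complexConj L) 2 ((StdForm.antidiagonal 2).over L)) : Subgroup (quasiSplit (↥(maximalRealSubfield L)) L (IsCMField.complexConj L) 2).Adelic)) × ℝ → ℂ := fun q => mellin f' (-((σ₀ : ℂ) + q.2 * I)) * (((((IdeleClassGroup.ideleNorm L q.1.1 : ℝ≥0) : ℝ) : ℂ) * ((((IdeleClassGroup.ideleNorm L q.1.1)⁻¹ : ℝ≥0) : ℝ) : ℂ) ^ ((σ₀ : ℂ) + q.2 * I)) * Iφ' (q.1.2, q.2)) with hS'def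
  have hS1 : Measurable fun q : ((AdeleRing (𝓞 L) L)ˣ × ((standardMaximalCompactGL 2 L).comap (adelicVal (↥(maximalRealSubfield L)) L (IsCMField.complexConj L) 2 ((StdForm.antidiagonal 2).over L)) : Subgroup (quasiSplit (↥(maximalRealSubfield L)) L (IsCMField.complexConj L) 2).Adelic)) × ℝ => mellin f' (-((σ₀ : ℂ) + q.2 * I)) := hmel.measurable.comp measurable_snd
  have hS2 : Measurable fun q : ((AdeleRing (𝓞 L) L)ˣ × ((standardMaximalCompactGL 2 L).comap (adelicVal (↥(maximalRealSubfield L)) L (IsCMField.complexConj L) 2 ((StdForm.antidiagonal 2).over L)) : Subgroup (quasiSplit (↥(maximalRealSubfield L)) L (IsCMField.complexConj L) 2).Adelic)) × ℝ => (((IdeleClassGroup.ideleNorm L q.1.1 : ℝ≥0) : ℝ) : ℂ) * ((((IdeleClassGroup.ideleNorm L q.1.1)⁻¹ : ℝ≥0) : ℝ) : ℂ) ^ ((σ₀ : ℂ) + q.2 * I) :=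
    ((continuous_ofReal.comp hIc).measurable.comp (measurable_fst.comp measurable_fst)).mul ((hIic.measurable.comp (measurable_fst.comp measurable_fst)).pow (by fun_prop))
  have hS3 : Measurable fun q : ((AdeleRing (𝓞 L) L)ˣ × ((standardMaximalCompactGL 2 L).comap (adelicVal (↥(maximalRealSubfield L)) L (IsCMField.complexConj L) 2 ((StdForm.antidiagonal 2).over L)) : Subgroup (quasiSplit (↥(maximalRealSubfield L)) L (IsCMField.complexConj L) 2).Adelic)) × ℝ => Iφ' (q.1.2, q.2) := hIφ'm.comp ((measurable_snd.comp measurable_fst).prodMk measurable_snd)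
  have hS'm : Measurable S' := hS1.mul (hS2.mul hS3)
  set Y' : (AdeleRing (𝓞 L) L)ˣ × ((standardMaximalCompactGL 2 L).comap (adelicVal (↥(maximalRealSubfield L)) L (IsCMField.complexConj L) 2 ((StdForm.antidiagonal 2).over L)) : Subgroup (quasiSplit (↥(maximalRealSubfield L)) L (IsCMField.complexConj L) 2).Adelic) → ℂ := fun p => ∫ y : ℝ, S' (p, y) with hY'def
  have hY'm : Measurable Y' := (hS'm.stronglyMeasurable.integral_prod_right' (ν := (volume : Measure ℝ))).measurable
  set T2' : (AdeleRing (𝓞 L) L)ˣ × ((standardMaximalCompactGL 2 L).comap (adelicVal (↥(maximalRealSubfield L)) L (IsCMField.complexConj L) 2 ((StdForm.antidiagonal 2).over L)) : Subgroup (quasiSplit (↥(maximalRealSubfield L)) L (IsCMField.complexConj L) 2).Adelic) → ℂ := fun p => φ (p.2 : (quasiSplit (↥(maximalRealSubfield L)) L (IsCMField.complexConj L) 2).Adelic) * conj (((ν 𝓕).toReal⁻¹ : ℝ) • ((((2 * π)⁻¹ : ℝ) : ℂ) * Y' p)) with hT2'def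
  have hsm : Measurable fun p : (AdeleRing (𝓞 L) L)ˣ × ((standardMaximalCompactGL 2 L).comap (adelicVal (↥(maximalRealSubfield L)) L (IsCMField.complexConj L) 2 ((StdForm.antidiagonal 2).over L)) : Subgroup (quasiSplit (↥(maximalRealSubfield L)) L (IsCMField.complexConj L) 2).Adelic) => ((ν 𝓕).toReal⁻¹ : ℝ) • ((((2 * π)⁻¹ : ℝ) : ℂ) * Y' p) := (measurable_const.mul hY'm).const_smul ((ν 𝓕).toReal⁻¹ : ℝ)
  have hT2'm : Measurable T2' := (hφc.measurable.comp (measurable_subtype_coe.comp measurable_snd)).mul (continuous_conj.measurable.comp hsm)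
  have hT2m : Measurable fun p : (AdeleRing (𝓞 L) L)ˣ × ((standardMaximalCompactGL 2 L).comap (adelicVal (↥(maximalRealSubfield L)) L (IsCMField.complexConj L) 2 ((StdForm.antidiagonal 2).over L)) : Subgroup (quasiSplit (↥(maximalRealSubfield L)) L (IsCMField.complexConj L) 2).Adelic) => φ (p.2 : (quasiSplit (↥(maximalRealSubfield L)) L (IsCMField.complexConj L) 2).Adelic) * conj (((ν 𝓕).toReal⁻¹ : ℝ) • ((((2 * π)⁻¹ : ℝ) : ℂ) * ∫ y : ℝ, mellin f' (-((σ₀ : ℂ) + y * I)) * (((((IdeleClassGroup.ideleNorm L p.1 : ℝ≥0) : ℝ) : ℂ) * ((((IdeleClassGroup.ideleNorm L p.1)⁻¹ : ℝ≥0) : ℝ) : ℂ) ^ ((σ₀ : ℂ) + y * I)) * ∫ v : ↥(adelicUnipotent (↥(maximalRealSubfield L)) L (IsCMField.complexConj L) 2), flatSectionU φ' ((σ₀ : ℂ) + y * I) (((quasiSplit (↥(maximalRealSubfield L)) L (IsCMField.complexConj L) 2).toAdelic (weylLongU ((IsCMField.complexConj L : L ≃ₐ[↥(maximalRealSubfield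 L)] L) : L →+* L) (rfl : (StdForm.antidiagonal 2).over L = (StdForm.antidiagonal 2).over L))) * ((v : (quasiSplit (↥(maximalRealSubfield L)) L (IsCMField.complexConj L) 2).Adelic) * (p.2 : (quasiSplit (↥(maximalRealSubfield L)) L (IsCMField.complexConj L) 2).Adelic))) ∂ν))) := hT2'm
  have hR2m : Measurable fun x : (AdeleRing (𝓞 L) L)ˣ => ∫ k : ((standardMaximalCompactGL 2 L).comap (adelicVal (↥(maximalRealSubfield L)) L (IsCMField.complexConj L) 2 ((StdForm.antidiagonal 2).over L)) : Subgroup (quasiSplit (↥(maximalRealSubfield L)) L (IsCMField.complexConj L) 2).Adelic), φ (k : (quasiSplit (↥(maximalRealSubfield L)) L (IsCMField.complexConj L) 2).Adelic) * conj (((ν 𝓕).toReal⁻¹ : ℝ) • ((((2 * π)⁻¹ : ℝ) : ℂ) * ∫ y : ℝ, mellin f' (-((σ₀ : ℂ) + y * I)) * (((((IdeleClassGroup.ideleNorm L x : ℝ≥0) : ℝ) : ℂ) * ((((IdeleClassGroup.ideleNorm L x)⁻¹ : ℝ≥0) : ℝ) : ℂ) ^ ((σ₀ : ℂ) + y * I))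 * ∫ v : ↥(adelicUnipotent (↥(maximalRealSubfield L)) L (IsCMField.complexConj L) 2), flatSectionU φ' ((σ₀ : ℂ) + y * I) (((quasiSplit (↥(maximalRealSubfield L)) L (IsCMField.complexConj L) 2).toAdelic (weylLongU ((IsCMField.complexConj L : L ≃ₐ[↥(maximalRealSubfield L)] L) : L →+* L) (rfl : (StdForm.antidiagonal 2).over L = (StdForm.antidiagonal 2).over L))) * ((v : (quasiSplit (↥(maximalRealSubfield L)) L (IsCMField.complexConj L) 2).Adelic) * (k : (quasiSplit (↥(maximalRealSubfield L)) L (IsCMField.complexConj L) 2).Adelic))) ∂ν))) ∂μK := (hT2'm.stronglyMeasurable.integral_prod_right' (ν := μK)).measurable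
  -- (3) at fixed `x`: both `K_U`-integrands are integrable
  have hPi : Integrable (fun k : ((standardMaximalCompactGL 2 L).comap (adelicVal (↥(maximalRealSubfield L)) L (IsCMField.complexConj L) 2 ((StdForm.antidiagonal 2).over L)) : Subgroup (quasiSplit (↥(maximalRealSubfield L)) L (IsCMField.complexConj L) 2).Adelic) => φ (k : (quasiSplit (↥(maximalRealSubfield L)) L (IsCMField.complexConj L) 2).Adelic) * conj (φ' (k : (quasiSplit (↥(maximalRealSubfield L)) L (IsCMField.complexConj L) 2).Adelic))) μK :=
    (integrable_const (Cφ * Cφ')).mono' ((hφc.comp continuous_subtype_val).mul (continuous_conj.comp (hφ'c.comp continuous_subtype_val))).aestronglyMeasurable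
      (ae_of_all _ fun k => by rw [norm_mul, Complex.norm_conj]; exact mul_le_mul (hφC _) (hφ'C _) (norm_nonneg _) hCφ)
  have hT2b : ∀ (x : (AdeleRing (𝓞 L) L)ˣ) (k : ((standardMaximalCompactGL 2 L).comap (adelicVal (↥(maximalRealSubfield L)) L (IsCMField.complexConj L) 2 ((StdForm.antidiagonal 2).over L)) : Subgroup (quasiSplit (↥(maximalRealSubfield L)) L (IsCMField.complexConj L) 2).Adelic)), ‖φ (k : (quasiSplit (↥(maximalRealSubfield L)) L (IsCMField.complexConj L) 2).Adelic) * conj (((ν 𝓕).toReal⁻¹ : ℝ) • ((((2 * π)⁻¹ : ℝ) : ℂ) * ∫ y : ℝ, mellin f' (-((σ₀ : ℂ) + y * I)) * (((((IdeleClassGroup.ideleNorm L x : ℝ≥0) : ℝ) : ℂ) * ((((IdeleClassGroup.ideleNorm L x)⁻¹ : ℝ≥0) : ℝ) : ℂ) ^ ((σ₀ : ℂ) + y * I)) * ∫ v : ↥(adelicUnipotent (↥(maximalRealSubfield L)) L (IsCMField.complexConj L) 2), flatSectionU φ' ((σ₀ : ℂ) + y * I) (((quasiSplit (↥(maximalRealSubfield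 L)) L (IsCMField.complexConj L) 2).toAdelic (weylLongU ((IsCMField.complexConj L : L ≃ₐ[↥(maximalRealSubfield L)] L) : L →+* L) (rfl : (StdForm.antidiagonal 2).over L = (StdForm.antidiagonal 2).over L))) * ((v : (quasiSplit (↥(maximalRealSubfield L)) L (IsCMField.complexConj L) 2).Adelic) * (k : (quasiSplit (↥(maximalRealSubfield L)) L (IsCMField.complexConj L) 2).Adelic))) ∂ν)))‖ ≤ Cφ * (|((ν 𝓕).toReal⁻¹ : ℝ)| * (‖(((2 * π)⁻¹ : ℝ) : ℂ)‖ * (Mf' * ((IdeleClassGroup.ideleNorm L x : ℝ) * (((IdeleClassGroup.ideleNorm L x)⁻¹ : ℝ≥0) : ℝ) ^ σ₀ * (Cφ' * c₀))))) := fun x k => by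
    rw [norm_mul, Complex.norm_conj, norm_smul, Real.norm_eq_abs, norm_mul]
    exact mul_le_mul (hφC _) (mul_le_mul_of_nonneg_left (mul_le_mul_of_nonneg_left (hYb x k) (norm_nonneg _)) (abs_nonneg _))
      (mul_nonneg (abs_nonneg _) (mul_nonneg (norm_nonneg _) (norm_nonneg _))) hCφ
  have hT2i : ∀ x : (AdeleRing (𝓞 L) L)ˣ, Integrable (fun k : ((standardMaximalCompactGL 2 L).comap (adelicVal (↥(maximalRealSubfield L)) L (IsCMField.complexConj L) 2 ((StdForm.antidiagonal 2).over L)) : Subgroup (quasiSplit (↥(maximalRealSubfield L)) L (IsCMField.complexConj L) 2).Adelic) => φ (k : (quasiSplit (↥(maximalRealSubfield L)) L (IsCMField.complexConj L) 2).Adelic) * conj (((ν 𝓕).toReal⁻¹ : ℝ) • ((((2 * π)⁻¹ : ℝ) : ℂ) * ∫ y : ℝ, mellin f' (-((σ₀ : ℂ) + y * I)) * (((((IdeleClassGroup.ideleNorm L x : ℝ≥0) : ℝ) : ℂ) * ((((IdeleClassGroup.ideleNorm L x)⁻¹ : ℝ≥0) : ℝ) : ℂ) ^ ((σ₀ : ℂ)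 + y * I)) * ∫ v : ↥(adelicUnipotent (↥(maximalRealSubfield L)) L (IsCMField.complexConj L) 2), flatSectionU φ' ((σ₀ : ℂ) + y * I) (((quasiSplit (↥(maximalRealSubfield L)) L (IsCMField.complexConj L) 2).toAdelic (weylLongU ((IsCMField.complexConj L : L ≃ₐ[↥(maximalRealSubfield L)] L) : L →+* L) (rfl : (StdForm.antidiagonal 2).over L = (StdForm.antidiagonal 2).over L))) * ((v : (quasiSplit (↥(maximalRealSubfield L)) L (IsCMField.complexConj L) 2).Adelic) * (k : (quasiSplit (↥(maximalRealSubfield L)) L (IsCMField.complexConj L) 2).Adelic))) ∂ν)))) μK := fun x =>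
    (integrable_const _).mono' (hT2m.comp (measurable_prodMk_left (x := x))).aestronglyMeasurable (ae_of_all _ fun k => hT2b x k)
  -- (4) the pointwise split of ★ W-b's `K_U`-integral
  have hYw : ∀ (x : (AdeleRing (𝓞 L) L)ˣ) (k : ((standardMaximalCompactGL 2 L).comap (adelicVal (↥(maximalRealSubfield L)) L (IsCMField.complexConj L) 2 ((StdForm.antidiagonal 2).over L)) : Subgroup (quasiSplit (↥(maximalRealSubfield L)) L (IsCMField.complexConj L) 2).Adelic)), ∫ y : ℝ, mellin f' (-((σ₀ : ℂ) + y * I)) * (((((IdeleClassGroup.ideleNorm L x : ℝ≥0) : ℝ) : ℂ) * ((((reflectChar (IsCMField.complexConj L) χ') x : ℂˣ) : ℂ) * ((((IdeleClassGroup.ideleNorm L x)⁻¹ : ℝ≥0) : ℝ) : ℂ) ^ ((σ₀ : ℂ) + y * I))) * ∫ v : ↥(adelicUnipotent (↥(maximalRealSubfield L)) L (IsCMField.complexConj L) 2), flatSectionU φ' ((σ₀ : ℂ) + y * I) (((quasiSplit (↥(maximalRealSubfield L)) L (IsCMField.complexConj L) 2).toAdelic (weylLongU ((IsCMField.complexConj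 L : L ≃ₐ[↥(maximalRealSubfield L)] L) : L →+* L) (rfl : (StdForm.antidiagonal 2).over L = (StdForm.antidiagonal 2).over L))) * ((v : (quasiSplit (↥(maximalRealSubfield L)) L (IsCMField.complexConj L) 2).Adelic) * (k : (quasiSplit (↥(maximalRealSubfield L)) L (IsCMField.complexConj L) 2).Adelic))) ∂ν) = (((reflectChar (IsCMField.complexConj L) χ') x : ℂˣ) : ℂ) * ∫ y : ℝ, mellin f' (-((σ₀ : ℂ) + y * I)) * (((((IdeleClassGroup.ideleNorm L x : ℝ≥0) : ℝ) : ℂ) * ((((IdeleClassGroup.ideleNorm L x)⁻¹ : ℝ≥0) : ℝ) : ℂ) ^ ((σ₀ : ℂ) + y * I)) * ∫ v : ↥(adelicUnipotent (↥(maximalRealSubfield L)) L (IsCMField.complexConj L) 2), flatSectionU φ' ((σ₀ : ℂ) + y * I) (((quasiSplit (↥(maximalRealSubfield L)) L (IsCMField.complexConj L) 2).toAdelic (weylLongU ((IsCMField.complexConj L : L ≃ₐ[↥(maximalRealSubfield L)] L) : L →+* L) (rfl : (StdForm.antidiagonal 2).over L = (StdForm.antidiagonal 2).over L))) * ((v :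 (quasiSplit (↥(maximalRealSubfield L)) L (IsCMField.complexConj L) 2).Adelic) * (k : (quasiSplit (↥(maximalRealSubfield L)) L (IsCMField.complexConj L) 2).Adelic))) ∂ν) := fun x k => by
    rw [← integral_const_mul]
    exact integral_congr_ae (ae_of_all _ fun y => by ring)
  have hΦsplit : ∀ x : (AdeleRing (𝓞 L) L)ˣ, ∫ k : ((standardMaximalCompactGL 2 L).comap (adelicVal (↥(maximalRealSubfield L)) L (IsCMField.complexConj L) 2 ((StdForm.antidiagonal 2).over L)) : Subgroup (quasiSplit (↥(maximalRealSubfield L)) L (IsCMField.complexConj L) 2).Adelic), f (IdeleClassGroup.ideleNorm L x : ℝ) * (((χ x : ℂˣ) : ℂ) * φ (k : (quasiSplit (↥(maximalRealSubfield L)) L (IsCMField.complexConj L) 2).Adelic)) * conj (f' (IdeleClassGroup.ideleNorm L x : ℝ) * (((χ' x : ℂˣ) : ℂ) * φ' (k : (quasiSplit (↥(maximalRealSubfield L)) L (IsCMField.complexConj L) 2).Adelic)) + ((ν 𝓕).toReal⁻¹ : ℝ) • ((((2 * π)⁻¹ : ℝ) : ℂ) * ∫ y : ℝ, mellin f' (-((σ₀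 : ℂ) + y * I)) * (((((IdeleClassGroup.ideleNorm L x : ℝ≥0) : ℝ) : ℂ) * ((((reflectChar (IsCMField.complexConj L) χ') x : ℂˣ) : ℂ) * ((((IdeleClassGroup.ideleNorm L x)⁻¹ : ℝ≥0) : ℝ) : ℂ) ^ ((σ₀ : ℂ) + y * I))) * ∫ v : ↥(adelicUnipotent (↥(maximalRealSubfield L)) L (IsCMField.complexConj L) 2), flatSectionU φ' ((σ₀ : ℂ) + y * I) (((quasiSplit (↥(maximalRealSubfield L)) L (IsCMField.complexConj L) 2).toAdelic (weylLongU ((IsCMField.complexConj L : L ≃ₐ[↥(maximalRealSubfield L)] L) : L →+* L) (rfl : (StdForm.antidiagonal 2).over L = (StdForm.antidiagonal 2).over L))) * ((v : (quasiSplit (↥(maximalRealSubfield L)) L (IsCMField.complexConj L) 2).Adelic) * (k : (quasiSplit (↥(maximalRealSubfield L)) L (IsCMField.complexConj L) 2).Adelic))) ∂ν))) ∂μK =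
      (((χ x : ℂˣ) : ℂ) * conj ((χ' x : ℂˣ) : ℂ)) * ((f (IdeleClassGroup.ideleNorm L x : ℝ) * conj (f' (IdeleClassGroup.ideleNorm L x : ℝ))) * ∫ k : ((standardMaximalCompactGL 2 L).comap (adelicVal (↥(maximalRealSubfield L)) L (IsCMField.complexConj L) 2 ((StdForm.antidiagonal 2).over L)) : Subgroup (quasiSplit (↥(maximalRealSubfield L)) L (IsCMField.complexConj L) 2).Adelic), φ (k : (quasiSplit (↥(maximalRealSubfield L)) L (IsCMField.complexConj L) 2).Adelic) * conj (φ' (k : (quasiSplit (↥(maximalRealSubfield L)) L (IsCMField.complexConj L) 2).Adelic)) ∂μK) +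
        (((χ x : ℂˣ) : ℂ) * conj (((reflectChar (IsCMField.complexConj L) χ') x : ℂˣ) : ℂ)) * (f (IdeleClassGroup.ideleNorm L x : ℝ) * ∫ k : ((standardMaximalCompactGL 2 L).comap (adelicVal (↥(maximalRealSubfield L)) L (IsCMField.complexConj L) 2 ((StdForm.antidiagonal 2).over L)) : Subgroup (quasiSplit (↥(maximalRealSubfield L)) L (IsCMField.complexConj L) 2).Adelic), φ (k : (quasiSplit (↥(maximalRealSubfield L)) L (IsCMField.complexConj L) 2).Adelic) * conj (((ν 𝓕).toReal⁻¹ : ℝ) • ((((2 * π)⁻¹ : ℝ) : ℂ) * ∫ y : ℝ, mellin f' (-((σ₀ : ℂ) + y * I)) * (((((IdeleClassGroup.ideleNorm L x : ℝ≥0) : ℝ) : ℂ) * ((((IdeleClassGroup.ideleNorm L x)⁻¹ : ℝ≥0) : ℝ) : ℂ) ^ ((σ₀ : ℂ) + y * I)) * ∫ v : ↥(adelicUnipotent (↥(maximalRealSubfield L)) L (IsCMField.complexConj L) 2), flatSectionU φ' ((σ₀ : ℂ) + y * I) (((quasiSplit (↥(maximalRealSubfield L)) L (IsCMField.complexConj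 L) 2).toAdelic (weylLongU ((IsCMField.complexConj L : L ≃ₐ[↥(maximalRealSubfield L)] L) : L →+* L) (rfl : (StdForm.antidiagonal 2).over L = (StdForm.antidiagonal 2).over L))) * ((v : (quasiSplit (↥(maximalRealSubfield L)) L (IsCMField.complexConj L) 2).Adelic) * (k : (quasiSplit (↥(maximalRealSubfield L)) L (IsCMField.complexConj L) 2).Adelic))) ∂ν))) ∂μK) := fun x => by
    rw [← integral_const_mul, ← integral_const_mul, ← integral_const_mul, ← integral_const_mul, ← integral_add ((hPi.const_mul _).const_mul _) (((hT2i x).const_mul _).const_mul _)]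
    refine integral_congr_ae (ae_of_all _ fun k => ?_)
    dsimp only
    rw [hYw x k]
    simp only [map_add, map_mul, Complex.real_smul]
    ring
  have hGsplit : ∀ x : (AdeleRing (𝓞 L) L)ˣ, (IdeleClassGroup.ideleNorm L x : ℝ)⁻¹ • (∫ k : ((standardMaximalCompactGL 2 L).comap (adelicVal (↥(maximalRealSubfield L)) L (IsCMField.complexConj L) 2 ((StdForm.antidiagonal 2).over L)) : Subgroup (quasiSplit (↥(maximalRealSubfield L)) L (IsCMField.complexConj L) 2).Adelic), f (IdeleClassGroup.ideleNorm L x : ℝ) * (((χ x : ℂˣ) : ℂ) * φ (k : (quasiSplit (↥(maximalRealSubfield L)) L (IsCMField.complexConj L) 2).Adelic)) * conj (f' (IdeleClassGroup.ideleNorm L x : ℝ) * (((χ' x : ℂˣ) : ℂ) * φ' (k : (quasiSplit (↥(maximalRealSubfield L)) L (IsCMField.complexConj L) 2).Adelic)) + ((ν 𝓕).toReal⁻¹ : ℝ) • ((((2 * π)⁻¹ : ℝ) : ℂ) * ∫ y : ℝ, mellin f' (-((σ₀ : ℂ) + y * I)) * (((((IdeleClassGroup.ideleNorm L x : ℝ≥0)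 : ℝ) : ℂ) * ((((reflectChar (IsCMField.complexConj L) χ') x : ℂˣ) : ℂ) * ((((IdeleClassGroup.ideleNorm L x)⁻¹ : ℝ≥0) : ℝ) : ℂ) ^ ((σ₀ : ℂ) + y * I))) * ∫ v : ↥(adelicUnipotent (↥(maximalRealSubfield L)) L (IsCMField.complexConj L) 2), flatSectionU φ' ((σ₀ : ℂ) + y * I) (((quasiSplit (↥(maximalRealSubfield L)) L (IsCMField.complexConj L) 2).toAdelic (weylLongU ((IsCMField.complexConj L : L ≃ₐ[↥(maximalRealSubfield L)] L) : L →+* L) (rfl : (StdForm.antidiagonal 2).over L = (StdForm.antidiagonal 2).over L))) * ((v : (quasiSplit (↥(maximalRealSubfield L)) L (IsCMField.complexConj L) 2).Adelic) * (k : (quasiSplit (↥(maximalRealSubfield L)) L (IsCMField.complexConj L) 2).Adelic))) ∂ν))) ∂μK) = (IdeleClassGroup.ideleNorm L x : ℝ)⁻¹ • ((((χ x : ℂˣ) : ℂ) * conj ((χ' x : ℂˣ) : ℂ)) * ((f (IdeleClassGroup.ideleNorm L x : ℝ) * conj (f' (IdeleClassGroup.ideleNorm L x : ℝ))) * ∫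 k : ((standardMaximalCompactGL 2 L).comap (adelicVal (↥(maximalRealSubfield L)) L (IsCMField.complexConj L) 2 ((StdForm.antidiagonal 2).over L)) : Subgroup (quasiSplit (↥(maximalRealSubfield L)) L (IsCMField.complexConj L) 2).Adelic), φ (k : (quasiSplit (↥(maximalRealSubfield L)) L (IsCMField.complexConj L) 2).Adelic) * conj (φ' (k : (quasiSplit (↥(maximalRealSubfield L)) L (IsCMField.complexConj L) 2).Adelic)) ∂μK)) + (IdeleClassGroup.ideleNorm L x : ℝ)⁻¹ • ((((χ x : ℂˣ) : ℂ) * conj (((reflectChar (IsCMField.complexConj L) χ') x : ℂˣ) : ℂ)) * (f (IdeleClassGroup.ideleNorm L x : ℝ) * ∫ k : ((standardMaximalCompactGL 2 L).comap (adelicVal (↥(maximalRealSubfield L)) L (IsCMField.complexConj L) 2 ((StdForm.antidiagonal 2).over L)) : Subgroup (quasiSplit (↥(maximalRealSubfield L)) L (IsCMField.complexConj L) 2).Adelic), φ (k : (quasiSplit (↥(maximalRealSubfield L)) L (IsCMField.complexConj L) 2).Adelic) * conj (((ν 𝓕).toReal⁻¹ : ℝ) • ((((2 * π)⁻¹ :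 ℝ) : ℂ) * ∫ y : ℝ, mellin f' (-((σ₀ : ℂ) + y * I)) * (((((IdeleClassGroup.ideleNorm L x : ℝ≥0) : ℝ) : ℂ) * ((((IdeleClassGroup.ideleNorm L x)⁻¹ : ℝ≥0) : ℝ) : ℂ) ^ ((σ₀ : ℂ) + y * I)) * ∫ v : ↥(adelicUnipotent (↥(maximalRealSubfield L)) L (IsCMField.complexConj L) 2), flatSectionU φ' ((σ₀ : ℂ) + y * I) (((quasiSplit (↥(maximalRealSubfield L)) L (IsCMField.complexConj L) 2).toAdelic (weylLongU ((IsCMField.complexConj L : L ≃ₐ[↥(maximalRealSubfield L)] L) : L →+* L) (rfl : (StdForm.antidiagonal 2).over L = (StdForm.antidiagonal 2).over L))) * ((v : (quasiSplit (↥(maximalRealSubfield L)) L (IsCMField.complexConj L) 2).Adelic) * (k : (quasiSplit (↥(maximalRealSubfield L)) L (IsCMField.complexConj L) 2).Adelic))) ∂ν))) ∂μK)) := fun x => by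
    rw [hΦsplit x, smul_add]
  -- (5) `G₁ ∈ L¹(𝓕_I)`: radial majorant `‖x‖⁻¹·|f(‖x‖)|·(B′·|A|)`
  obtain ⟨B', hB'⟩ := hf's.exists_bound_of_continuous hf'.continuous
  have hfinD : ∀ D : ℝ, ∫⁻ x in 𝓕I, (((IdeleClassGroup.ideleNorm L x)⁻¹ : ℝ≥0) : ℝ≥0∞) * (‖f (IdeleClassGroup.ideleNorm L x : ℝ)‖ₑ * ENNReal.ofReal D) ∂νI < ∞ := fun D => by
    rw [setLIntegral_inv_ideleNorm_mul_comp_eq νI h𝓕I (Gm := fun r => ‖f r‖ₑ * ENNReal.ofReal D) (hf.continuous.measurable.enorm.mul_const _)]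
    exact ENNReal.mul_lt_top hVt.lt_top (setLIntegral_inv_mul_inv_mul_enorm_lt_top hf.continuous hfs hf0 ENNReal.ofReal_ne_top)
  have henorm : ∀ (x : (AdeleRing (𝓞 L) L)ˣ) {v : ℂ} {D : ℝ}, 0 ≤ D → ‖v‖ ≤ (IdeleClassGroup.ideleNorm L x : ℝ)⁻¹ * (‖f (IdeleClassGroup.ideleNorm L x : ℝ)‖ * D) →
      ‖v‖ₑ ≤ (((IdeleClassGroup.ideleNorm L x)⁻¹ : ℝ≥0) : ℝ≥0∞) * (‖f (IdeleClassGroup.ideleNorm L x : ℝ)‖ₑ * ENNReal.ofReal D) := fun x v D hD hv => by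
    rw [← ofReal_norm, ← ofReal_norm, ← ENNReal.ofReal_coe_nnreal, ← ENNReal.ofReal_mul (norm_nonneg _), ← ENNReal.ofReal_mul (NNReal.coe_nonneg _), NNReal.coe_inv]
    exact ENNReal.ofReal_le_ofReal hv
  have hG₁i : IntegrableOn (fun x : (AdeleRing (𝓞 L) L)ˣ => (IdeleClassGroup.ideleNorm L x : ℝ)⁻¹ • ((((χ x : ℂˣ) : ℂ) * conj ((χ' x : ℂˣ) : ℂ)) * ((f (IdeleClassGroup.ideleNorm L x : ℝ) * conj (f' (IdeleClassGroup.ideleNorm L x : ℝ))) * ∫ k : ((standardMaximalCompactGL 2 L).comap (adelicVal (↥(maximalRealSubfield L)) L (IsCMField.complexConj L) 2 ((StdForm.antidiagonal 2).over L)) : Subgroup (quasiSplit (↥(maximalRealSubfield L)) L (IsCMField.complexConj L) 2).Adelic), φ (k : (quasiSplit (↥(maximalRealSubfield L)) L (IsCMField.complexConj L) 2).Adelic) * conj (φ' (k : (quasiSplit (↥(maximalRealSubfield L)) L (IsCMField.complexConj L) 2).Adelic)) ∂μK))) 𝓕I νI := by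
    have hm : Measurable fun x : (AdeleRing (𝓞 L) L)ˣ => (IdeleClassGroup.ideleNorm L x : ℝ)⁻¹ • ((((χ x : ℂˣ) : ℂ) * conj ((χ' x : ℂˣ) : ℂ)) * ((f (IdeleClassGroup.ideleNorm L x : ℝ) * conj (f' (IdeleClassGroup.ideleNorm L x : ℝ))) * ∫ k : ((standardMaximalCompactGL 2 L).comap (adelicVal (↥(maximalRealSubfield L)) L (IsCMField.complexConj L) 2 ((StdForm.antidiagonal 2).over L)) : Subgroup (quasiSplit (↥(maximalRealSubfield L)) L (IsCMField.complexConj L) 2).Adelic), φ (k : (quasiSplit (↥(maximalRealSubfield L)) L (IsCMField.complexConj L) 2).Adelic) * conj (φ' (k : (quasiSplit (↥(maximalRealSubfield L)) L (IsCMField.complexConj L) 2).Adelic)) ∂μK)) :=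
      (hIc.measurable.inv).smul (((((hχc χ).measurable).mul (continuous_conj.measurable.comp (hχc χ').measurable))).mul
        ((((hf.continuous.comp hIc).measurable).mul (continuous_conj.measurable.comp (hf'.continuous.comp hIc).measurable)).mul measurable_const))
    refine ⟨hm.aestronglyMeasurable, ?_⟩
    show ∫⁻ x in 𝓕I, ‖(IdeleClassGroup.ideleNorm L x : ℝ)⁻¹ • ((((χ x : ℂˣ) : ℂ) * conj ((χ' x : ℂˣ) : ℂ)) * ((f (IdeleClassGroup.ideleNorm L x : ℝ) * conj (f' (IdeleClassGroup.ideleNorm L x : ℝ))) * ∫ k : ((standardMaximalCompactGL 2 L).comap (adelicVal (↥(maximalRealSubfield L)) L (IsCMField.complexConj L) 2 ((StdForm.antidiagonal 2).over L)) : Subgroup (quasiSplit (↥(maximalRealSubfield L)) L (IsCMField.complexConj L) 2).Adelic), φ (k : (quasiSplit (↥(maximalRealSubfield L)) L (IsCMField.complexConj L) 2).Adelic) * conj (φ' (k : (quasiSplit (↥(maximalRealSubfield L)) L (IsCMField.complexConj L) 2).Adelic)) ∂μK))‖ₑ ∂νI < ∞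
    refine lt_of_le_of_lt (lintegral_mono fun x => henorm x (mul_nonneg ((norm_nonneg _).trans (hB' 1)) (norm_nonneg _)) ?_) (hfinD (B' * ‖∫ k : ((standardMaximalCompactGL 2 L).comap (adelicVal (↥(maximalRealSubfield L)) L (IsCMField.complexConj L) 2 ((StdForm.antidiagonal 2).over L)) : Subgroup (quasiSplit (↥(maximalRealSubfield L)) L (IsCMField.complexConj L) 2).Adelic), φ (k : (quasiSplit (↥(maximalRealSubfield L)) L (IsCMField.complexConj L) 2).Adelic) * conj (φ' (k : (quasiSplit (↥(maximalRealSubfield L)) L (IsCMField.complexConj L) 2).Adelic)) ∂μK‖))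
    rw [norm_smul, norm_inv, Real.norm_of_nonneg (NNReal.coe_nonneg _), norm_mul, norm_mul, norm_mul, norm_mul, Complex.norm_conj, Complex.norm_conj, hχu, hχ'u, one_mul, one_mul]
    exact mul_le_mul_of_nonneg_left (by rw [mul_assoc]; exact mul_le_mul_of_nonneg_left (mul_le_mul_of_nonneg_right (hB' _) (norm_nonneg _)) (norm_nonneg _)) (inv_nonneg.2 (NNReal.coe_nonneg _))
  -- (6) `G₂ ∈ L¹(𝓕_I)`: radial majorant through the uniform Godement bound and the cut-off `T` (`T⁻¹ ≤ ‖x‖ ≤ T` on `supp f∘‖·‖`)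
  have hMf'0 : 0 ≤ Mf' := integral_nonneg fun _ => norm_nonneg _
  have hc₀0 : 0 ≤ c₀ := integral_nonneg fun _ => Real.rpow_nonneg (NNReal.coe_nonneg _) _
  set D₂ : ℝ := Cφ * (|((ν 𝓕).toReal⁻¹ : ℝ)| * (‖(((2 * π)⁻¹ : ℝ) : ℂ)‖ * (Mf' * ((T : ℝ) * (T : ℝ) ^ σ₀ * (Cφ' * c₀))))) * μK.real Set.univ with hD₂
  have hD₂0 : 0 ≤ D₂ := mul_nonneg (mul_nonneg hCφ (mul_nonneg (abs_nonneg _) (mul_nonneg (norm_nonneg _)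
    (mul_nonneg hMf'0 (mul_nonneg (mul_nonneg hT0.le (Real.rpow_nonneg hT0.le _)) (mul_nonneg hCφ' hc₀0)))))) measureReal_nonneg
  have hR2b : ∀ x : (AdeleRing (𝓞 L) L)ˣ, f (IdeleClassGroup.ideleNorm L x : ℝ) ≠ 0 → ‖∫ k : ((standardMaximalCompactGL 2 L).comap (adelicVal (↥(maximalRealSubfield L)) L (IsCMField.complexConj L) 2 ((StdForm.antidiagonal 2).over L)) : Subgroup (quasiSplit (↥(maximalRealSubfield L)) L (IsCMField.complexConj L) 2).Adelic), φ (k : (quasiSplit (↥(maximalRealSubfield L)) L (IsCMField.complexConj L) 2).Adelic) * conj (((ν 𝓕).toReal⁻¹ : ℝ) • ((((2 * π)⁻¹ : ℝ) : ℂ) * ∫ y : ℝ, mellin f' (-((σ₀ : ℂ) + y * I)) * (((((IdeleClassGroup.ideleNorm L x : ℝ≥0) : ℝ) : ℂ) * ((((IdeleClassGroup.ideleNorm L x)⁻¹ : ℝ≥0) : ℝ) : ℂ) ^ ((σ₀ : ℂ) + y * I)) * ∫ v : ↥(adelicUnipotent (↥(maximalRealSubfield L)) L (IsCMField.complexConj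 L) 2), flatSectionU φ' ((σ₀ : ℂ) + y * I) (((quasiSplit (↥(maximalRealSubfield L)) L (IsCMField.complexConj L) 2).toAdelic (weylLongU ((IsCMField.complexConj L : L ≃ₐ[↥(maximalRealSubfield L)] L) : L →+* L) (rfl : (StdForm.antidiagonal 2).over L = (StdForm.antidiagonal 2).over L))) * ((v : (quasiSplit (↥(maximalRealSubfield L)) L (IsCMField.complexConj L) 2).Adelic) * (k : (quasiSplit (↥(maximalRealSubfield L)) L (IsCMField.complexConj L) 2).Adelic))) ∂ν))) ∂μK‖ ≤ D₂ := fun x hx => by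
    have hTr : (T : ℝ)⁻¹ ≤ (IdeleClassGroup.ideleNorm L x : ℝ) := not_lt.1 fun h => hx (hlo _ h)
    have hrT : (IdeleClassGroup.ideleNorm L x : ℝ) ≤ T := not_lt.1 fun h => hx (hhi _ h)
    have hr0 : (0 : ℝ) < (IdeleClassGroup.ideleNorm L x : ℝ) := ideleNorm_real_pos x
    have hinv : (((IdeleClassGroup.ideleNorm L x)⁻¹ : ℝ≥0) : ℝ) ≤ T := by rw [NNReal.coe_inv, inv_le_comm₀ hr0 hT0]; exact hTr
    have hpow : (IdeleClassGroup.ideleNorm L x : ℝ) * (((IdeleClassGroup.ideleNorm L x)⁻¹ : ℝ≥0) : ℝ) ^ σ₀ ≤ (T : ℝ) * (T : ℝ) ^ σ₀ :=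
      mul_le_mul hrT (Real.rpow_le_rpow (NNReal.coe_nonneg _) hinv (zero_le_one.trans hσ₀.le)) (Real.rpow_nonneg (NNReal.coe_nonneg _) _) hT0.le
    have hpt : ∀ k : ((standardMaximalCompactGL 2 L).comap (adelicVal (↥(maximalRealSubfield L)) L (IsCMField.complexConj L) 2 ((StdForm.antidiagonal 2).over L)) : Subgroup (quasiSplit (↥(maximalRealSubfield L)) L (IsCMField.complexConj L) 2).Adelic), ‖φ (k : (quasiSplit (↥(maximalRealSubfield L)) L (IsCMField.complexConj L) 2).Adelic) * conj (((ν 𝓕).toReal⁻¹ : ℝ) • ((((2 * π)⁻¹ : ℝ) : ℂ) * ∫ y : ℝ, mellin f' (-((σ₀ : ℂ) + y * I)) * (((((IdeleClassGroup.ideleNorm L x : ℝ≥0) : ℝ) : ℂ) * ((((IdeleClassGroup.ideleNorm L x)⁻¹ : ℝ≥0) : ℝ) : ℂ) ^ ((σ₀ : ℂ) + y * I)) * ∫ v : ↥(adelicUnipotent (↥(maximalRealSubfield L)) L (IsCMField.complexConj L) 2), flatSectionU φ' ((σ₀ : ℂ) + y * I) (((quasiSplit (↥(maximalRealSubfield L))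 L (IsCMField.complexConj L) 2).toAdelic (weylLongU ((IsCMField.complexConj L : L ≃ₐ[↥(maximalRealSubfield L)] L) : L →+* L) (rfl : (StdForm.antidiagonal 2).over L = (StdForm.antidiagonal 2).over L))) * ((v : (quasiSplit (↥(maximalRealSubfield L)) L (IsCMField.complexConj L) 2).Adelic) * (k : (quasiSplit (↥(maximalRealSubfield L)) L (IsCMField.complexConj L) 2).Adelic))) ∂ν)))‖ ≤ Cφ * (|((ν 𝓕).toReal⁻¹ : ℝ)| * (‖(((2 * π)⁻¹ : ℝ) : ℂ)‖ * (Mf' * ((T : ℝ) * (T : ℝ) ^ σ₀ * (Cφ' * c₀))))) := fun k =>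
      (hT2b x k).trans (mul_le_mul_of_nonneg_left (mul_le_mul_of_nonneg_left (mul_le_mul_of_nonneg_left (mul_le_mul_of_nonneg_left
        (mul_le_mul_of_nonneg_right hpow (mul_nonneg hCφ' hc₀0)) hMf'0) (norm_nonneg _)) (abs_nonneg _)) hCφ)
    exact norm_integral_le_of_norm_le_const (ae_of_all _ hpt)
  have hG₂b : ∀ x : (AdeleRing (𝓞 L) L)ˣ, ‖(IdeleClassGroup.ideleNorm L x : ℝ)⁻¹ • ((((χ x : ℂˣ) : ℂ) * conj (((reflectChar (IsCMField.complexConj L) χ') x : ℂˣ) : ℂ)) * (f (IdeleClassGroup.ideleNorm L x : ℝ) * ∫ k : ((standardMaximalCompactGL 2 L).comap (adelicVal (↥(maximalRealSubfield L)) L (IsCMField.complexConj L) 2 ((StdForm.antidiagonal 2).over L)) : Subgroup (quasiSplit (↥(maximalRealSubfield L)) L (IsCMField.complexConj L) 2).Adelic), φ (k : (quasiSplit (↥(maximalRealSubfield L)) L (IsCMField.complexConj L) 2).Adelic) * conj (((ν 𝓕).toReal⁻¹ : ℝ) • ((((2 * π)⁻¹ : ℝ) : ℂ) * ∫ y : ℝ,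 mellin f' (-((σ₀ : ℂ) + y * I)) * (((((IdeleClassGroup.ideleNorm L x : ℝ≥0) : ℝ) : ℂ) * ((((IdeleClassGroup.ideleNorm L x)⁻¹ : ℝ≥0) : ℝ) : ℂ) ^ ((σ₀ : ℂ) + y * I)) * ∫ v : ↥(adelicUnipotent (↥(maximalRealSubfield L)) L (IsCMField.complexConj L) 2), flatSectionU φ' ((σ₀ : ℂ) + y * I) (((quasiSplit (↥(maximalRealSubfield L)) L (IsCMField.complexConj L) 2).toAdelic (weylLongU ((IsCMField.complexConj L : L ≃ₐ[↥(maximalRealSubfield L)] L) : L →+* L) (rfl : (StdForm.antidiagonal 2).over L = (StdForm.antidiagonal 2).over L))) * ((v : (quasiSplit (↥(maximalRealSubfield L)) L (IsCMField.complexConj L) 2).Adelic) * (k : (quasiSplit (↥(maximalRealSubfield L)) L (IsCMField.complexConj L) 2).Adelic))) ∂ν))) ∂μK))‖ ≤ (IdeleClassGroup.ideleNorm L x : ℝ)⁻¹ * (‖f (IdeleClassGroup.ideleNorm L x : ℝ)‖ * D₂) := fun x => by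
    by_cases hx : f (IdeleClassGroup.ideleNorm L x : ℝ) = 0
    · rw [hx]
      simp only [zero_mul, mul_zero, smul_zero, norm_zero, le_refl]
    · rw [norm_smul, norm_inv, Real.norm_of_nonneg (NNReal.coe_nonneg _), norm_mul, norm_mul, norm_mul, Complex.norm_conj, hχu, norm_reflectChar_apply_of_isUnitary hχ'u, one_mul, one_mul]
      exact mul_le_mul_of_nonneg_left (mul_le_mul_of_nonneg_left (hR2b x hx) (norm_nonneg _)) (inv_nonneg.2 (NNReal.coe_nonneg _))
  have hG₂i : IntegrableOn (fun x : (AdeleRing (𝓞 L) L)ˣ => (IdeleClassGroup.ideleNorm L x : ℝ)⁻¹ • ((((χ x : ℂˣ) : ℂ) * conj (((reflectChar (IsCMField.complexConj L) χ') x : ℂˣ) : ℂ)) * (f (IdeleClassGroup.ideleNorm L x : ℝ) * ∫ k : ((standardMaximalCompactGL 2 L).comap (adelicVal (↥(maximalRealSubfield L)) L (IsCMField.complexConj L) 2 ((StdForm.antidiagonal 2).over L)) : Subgroup (quasiSplit (↥(maximalRealSubfield L)) L (IsCMField.complexConj L) 2).Adelic), φ (k : (quasiSplit (↥(maximalRealSubfield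 L)) L (IsCMField.complexConj L) 2).Adelic) * conj (((ν 𝓕).toReal⁻¹ : ℝ) • ((((2 * π)⁻¹ : ℝ) : ℂ) * ∫ y : ℝ, mellin f' (-((σ₀ : ℂ) + y * I)) * (((((IdeleClassGroup.ideleNorm L x : ℝ≥0) : ℝ) : ℂ) * ((((IdeleClassGroup.ideleNorm L x)⁻¹ : ℝ≥0) : ℝ) : ℂ) ^ ((σ₀ : ℂ) + y * I)) * ∫ v : ↥(adelicUnipotent (↥(maximalRealSubfield L)) L (IsCMField.complexConj L) 2), flatSectionU φ' ((σ₀ : ℂ) + y * I) (((quasiSplit (↥(maximalRealSubfield L)) L (IsCMField.complexConj L) 2).toAdelic (weylLongU ((IsCMField.complexConj L : L ≃ₐ[↥(maximalRealSubfield L)] L) : L →+* L) (rfl : (StdForm.antidiagonal 2).over L = (StdForm.antidiagonal 2).over L))) * ((v : (quasiSplit (↥(maximalRealSubfield L)) L (IsCMField.complexConj L) 2).Adelic) * (k : (quasiSplit (↥(maximalRealSubfield L)) L (IsCMField.complexConj L) 2).Adelic))) ∂ν))) ∂μK))) 𝓕I νI := by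
    have hG₂'m : Measurable fun x : (AdeleRing (𝓞 L) L)ˣ => (IdeleClassGroup.ideleNorm L x : ℝ)⁻¹ • ((((χ x : ℂˣ) : ℂ) * conj (((reflectChar (IsCMField.complexConj L) χ') x : ℂˣ) : ℂ)) * (f (IdeleClassGroup.ideleNorm L x : ℝ) * ∫ k : ((standardMaximalCompactGL 2 L).comap (adelicVal (↥(maximalRealSubfield L)) L (IsCMField.complexConj L) 2 ((StdForm.antidiagonal 2).over L)) : Subgroup (quasiSplit (↥(maximalRealSubfield L)) L (IsCMField.complexConj L) 2).Adelic), T2' (x, k) ∂μK)) :=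
      (hIc.measurable.inv).smul ((((hχc χ).measurable).mul (continuous_conj.measurable.comp (hχc (reflectChar (IsCMField.complexConj L) χ')).measurable)).mul
        (((hf.continuous.comp hIc).measurable).mul hR2m))
    refine ⟨hG₂'m.aestronglyMeasurable, ?_⟩
    exact lt_of_le_of_lt (lintegral_mono fun x => henorm x hD₂0 (hG₂b x)) (hfinD D₂)
  -- (7) assembly
  refine ⟨hG₁i, hG₂i, hInt, ?_⟩
  rw [hEq, ← integral_add hG₁i hG₂i]
  congr 1
  exact setIntegral_congr_fun h𝓕I.measurableSet fun x _ => hGsplit x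

end Summit.HodgeConjecture.HodgeConjecture.Cruxes.H413.K2E1ChiPseudoEisensteinIdeleSplitCMTwo

end
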